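import Summits.ValiantsHypothesis.ValiantsHypothesis.Theorems.SymmetroidPencilBasics

/-!
# `MatrixDescartes` census — the HIERARCHICAL LIFTING LEMMA (part 1): alternation chains and the lifting steps

HONEST FRAMING.  Object-search cell `pub-symmetroid`, crux `Theses.LacunarySymmetroid.MatrixDescartes`
(stmt-ValiantsHypothesis-18050); this file is a HELPER of that item with no closure claim.  It is the polynomial half of
the elementary perturbation statement §2(g) of the theory seat's RESIDUE-READING note (theory g20, 2026-08-25; typer duty
W1 of the desk's ruling R1260), whose pencil form — «a boundary seventeen on `F₀(d)` lifts to a twenty on the same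
support», for the V = 20 programme of `DoorA26 = PosRootLawAt 2 6 19` (OPEN, never asserted) — is the companion module
`…CensusBoundaryLift`.  Everything here is about an arbitrary real polynomial; nothing bounds `ζ`; nothing bears on
`MatrixDescartes` or on `VP ≠ VNP`.

Contents (all PROVED, Mathlib + the tree lemma `SymmetroidDescartes.le_card_posRoots_of_alternating` only):
* `AltChain p N s a` — an ALTERNATION CHAIN of `N + 1` positive points for `p`, anchored with sign `s`;
  `le_card_posRoots_of_altChain` (`⇒ ≥ N` distinct positive roots).
* `altChain_lift_step` — ONE LIFTING STEP: `g` of order `> e` at `0` with a chain of length `N + 1`, `r` of order exactly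
  `e`; for every non-zero `η` below an explicit bound (`min |g(aᵢ)| / (max |r(aᵢ)| + 1)`) with `sign (η r_e) = −sign s`,
  `g + η r` has a chain of length `N + 2` (one NEW alternation point below `a₀`, old points kept), anchored with sign
  `η r_e` — so the step ITERATES at any lower order (Newton-polygon scales).
* `exists_small_of_sign`, `altChain_lift_three` — three steps at orders `e₂ > e₁ > e₀`: chain length `N + 1 ↦ N + 4`,
  hence `≥ N + 3` distinct positive roots.

[folklore] Elementary real analysis of polynomials (intermediate values, continuity at `0`); no citation exists or is
needed.
-/

-- `Summit.ValiantsHypothesis.ValiantsHypothesis.…` repeats a component by the D-0017 layout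
-- (single-conjunct summit), which the `dupNamespace` linter flags; the name is mandated.
set_option linter.dupNamespace false

open Polynomial Finset
open scoped BigOperators Polynomial

namespace Summit.ValiantsHypothesis.ValiantsHypothesis.Theorems.LacunarySymmetroidMatrixDescartes.Census

/-- An ALTERNATION CHAIN of length `N + 1` for `p`, ANCHORED with sign `s`: positive points
`a₀ < a₁ < ⋯ < a_N` on which `p` alternates in sign, the sign of `p (a₀)` being that of `s`. [definition of the cell] -/
def AltChain (p : ℝ[X]) (N : ℕ) (s : ℝ) (a : Fin (N + 1) → ℝ) : Prop :=
  StrictMono a ∧ 0 < a 0 ∧ (∀ i : Fin N, p.eval (a i.castSucc) * p.eval (a i.succ) < 0) ∧ 0 < s * p.eval (a 0)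

/-- An alternation chain of length `N + 1` on positive points gives `N` distinct positive roots (tree lemma
`SymmetroidDescartes.le_card_posRoots_of_alternating`). [folklore] -/
theorem le_card_posRoots_of_altChain {p : ℝ[X]} {N : ℕ} {s : ℝ} {a : Fin (N + 1) → ℝ}
    (h : AltChain p N s a) : N ≤ (p.roots.toFinset.filter (fun t => 0 < t)).card :=
  SymmetroidDescartes.le_card_posRoots_of_alternating p N a h.1
    (fun j => lt_of_lt_of_le h.2.1 (h.1.monotone (Fin.zero_le j))) h.2.2.1

/-- sign bookkeeping: `u x > 0`, `v y > 0`, `u v < 0` force `x y < 0`. [folklore] -/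
theorem mul_neg_of_sign_transfer {x y u v : ℝ} (h1 : 0 < u * x) (h2 : 0 < v * y) (h3 : u * v < 0) :
    x * y < 0 := by
  by_contra h
  push Not at h
  have h4 : 0 < (u * v) * (x * y) := by
    have := mul_pos h1 h2
    calc (0 : ℝ) < u * x * (v * y) := this
      _ = (u * v) * (x * y) := by ring
  have h5 : (u * v) * (x * y) ≤ 0 := mul_nonpos_of_nonpos_of_nonneg h3.le h
  linarith

/-- **ONE LIFTING STEP.**  Let `g` vanish to order `> e` at `0` and carry an alternation chain of length `N + 1` on positive
points with anchor sign `s`; let `r` vanish to order exactly `e` at `0`.  Then for every non-zero `η` small enough with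
`sign (η · r_e) = −sign s`, the perturbed polynomial `g + η·r` carries an alternation chain of length `N + 2` anchored with
sign `η · r_e` (one NEW alternation point below `a₀`, the old points kept).  Since `g + η·r` vanishes to order `≥ e` at `0`
with `e`-th coefficient `η · r_e`, the step iterates at any lower order. [folklore] -/
theorem altChain_lift_step (g r : ℝ[X]) (e : ℕ) (hg : ∀ k ≤ e, g.coeff k = 0)
    (hr : ∀ k < e, r.coeff k = 0) (hre : r.coeff e ≠ 0)
    (N : ℕ) (s : ℝ) (a : Fin (N + 1) → ℝ) (hchain : AltChain g N s a) :
    ∃ η₀ : ℝ, 0 < η₀ ∧ ∀ η : ℝ, η ≠ 0 → |η| < η₀ → η * r.coeff e * s < 0 →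
      ∃ a' : Fin (N + 2) → ℝ, a' 0 < a 0 ∧ (∀ i : Fin (N + 1), a' i.succ = a i) ∧
        AltChain (g + C η * r) (N + 1) (η * r.coeff e) a' := by
  obtain ⟨hmono, ha0, halt, hanc⟩ := hchain
  -- every `g (a i)` is non-zero
  have hgnz : ∀ i, g.eval (a i) ≠ 0 := by
    intro i
    rcases Fin.eq_zero_or_eq_succ i with h | ⟨j, rfl⟩
    · subst h
      intro h0; rw [h0, mul_zero] at hanc; exact lt_irrefl _ hanc
    · intro h0; have := halt j; rw [h0, mul_zero] at this; exact lt_irrefl _ this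
  -- μ = min |g (a i)|, S = max |r (a i)|
  have hne : (Finset.univ : Finset (Fin (N + 1))).Nonempty := ⟨0, mem_univ _⟩
  set μ : ℝ := Finset.univ.inf' hne (fun i => |g.eval (a i)|) with hμ
  set S : ℝ := Finset.univ.sup' hne (fun i => |r.eval (a i)|) with hS
  have hμpos : 0 < μ := by
    rw [hμ, Finset.lt_inf'_iff]; intro i _; exact abs_pos.mpr (hgnz i)
  have hμle : ∀ i, μ ≤ |g.eval (a i)| := fun i => Finset.inf'_le _ (mem_univ i)
  have hSge : ∀ i, |r.eval (a i)| ≤ S := fun i => Finset.le_sup' (fun i => |r.eval (a i)|) (mem_univ i)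
  have hS0 : 0 ≤ S := (abs_nonneg _).trans (hSge 0)
  refine ⟨μ / (S + 1), div_pos hμpos (by linarith), ?_⟩
  intro η hη hsmall hsign
  set f : ℝ[X] := g + C η * r with hf
  -- (1) at the old points the perturbation does not change the sign
  have hpert : ∀ i, |η * r.eval (a i)| < |g.eval (a i)| := by
    intro i
    have h1 : |η * r.eval (a i)| = |η| * |r.eval (a i)| := abs_mul _ _
    have h2 : |η| * |r.eval (a i)| ≤ |η| * S := mul_le_mul_of_nonneg_left (hSge i) (abs_nonneg _)
    have h3 : |η| * S ≤ μ / (S + 1) * S := mul_le_mul_of_nonneg_right hsmall.le hS0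
    have h4 : μ / (S + 1) * S < μ := by
      rw [div_mul_eq_mul_div, div_lt_iff₀ (by linarith)]
      nlinarith
    linarith [hμle i]
  have hkeep : ∀ i, 0 < g.eval (a i) * f.eval (a i) := by
    intro i
    have h1 := hpert i
    have h2 : -(|η * r.eval (a i)| * |g.eval (a i)|) ≤ (η * r.eval (a i)) * g.eval (a i) := by
      rw [← abs_mul]; exact neg_abs_le _
    have h3 : 0 < |g.eval (a i)| * (|g.eval (a i)| - |η * r.eval (a i)|) :=
      mul_pos (abs_pos.mpr (hgnz i)) (sub_pos.mpr h1)
    have h4 : g.eval (a i) * f.eval (a i) = g.eval (a i) ^ 2 + (η * r.eval (a i)) * g.eval (a i) := by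
      rw [hf]; simp only [eval_add, eval_mul, eval_C]; ring
    rw [h4]; nlinarith [sq_abs (g.eval (a i))]
  -- (2) the new point near zero: `f = X^e · f₁`, `f₁ (0) = η r_e =: c`
  have hdvd : (X : ℝ[X]) ^ e ∣ f := by
    rw [X_pow_dvd_iff]
    intro k hk
    rw [hf, coeff_add, coeff_C_mul, hg k hk.le, hr k hk, mul_zero, add_zero]
  obtain ⟨f₁, hf₁⟩ := hdvd
  set c : ℝ := η * r.coeff e with hc
  have hcne : c ≠ 0 := mul_ne_zero hη hre
  have hf₁0 : f₁.coeff 0 = c := by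
    have h1 : f.coeff e = c := by
      rw [hf, coeff_add, coeff_C_mul, hg e le_rfl, zero_add]
    rw [hf₁] at h1
    have h2 : ((X : ℝ[X]) ^ e * f₁).coeff (0 + e) = f₁.coeff 0 := coeff_X_pow_mul f₁ e 0
    rw [zero_add] at h2
    rw [← h2, h1]
  -- `f₁ = X · q + C c`
  set q : ℝ[X] := f₁.divX with hq
  have hf₁eq : f₁ = X * q + C c := by rw [hq, ← hf₁0, X_mul_divX_add]
  have hfeval : ∀ t : ℝ, f.eval t = t ^ e * (t * q.eval t + c) := by
    intro t
    rw [hf₁, hf₁eq]; simp only [eval_mul, eval_pow, eval_X, eval_add, eval_C]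
  -- continuity of `t ↦ t · q t` at `0`
  have hcont : ContinuousAt (fun t : ℝ => (X * q).eval t) 0 := (X * q).continuous.continuousAt
  rw [Metric.continuousAt_iff] at hcont
  obtain ⟨δ, hδ, hδε⟩ := hcont (|c| / 2) (by positivity)
  set t₀ : ℝ := min (δ / 2) (a 0 / 2) with ht₀
  have ht₀pos : 0 < t₀ := lt_min (by linarith) (by linarith)
  have ht₀lt : t₀ < a 0 := lt_of_le_of_lt (min_le_right _ _) (by linarith)
  have ht₀δ : dist t₀ 0 < δ := by
    rw [Real.dist_eq, sub_zero, abs_of_pos ht₀pos]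
    exact lt_of_le_of_lt (min_le_left _ _) (by linarith)
  have hsmallq : |t₀ * q.eval t₀| < |c| / 2 := by
    have := hδε ht₀δ
    simp only [eval_mul, eval_X, zero_mul, Real.dist_eq, sub_zero] at this
    exact this
  have hnew : 0 < c * f.eval t₀ := by
    rw [hfeval]
    have h1 : 0 < t₀ ^ e := pow_pos ht₀pos e
    have h2 : 0 < c * (t₀ * q.eval t₀ + c) := by
      have h3 : -(|c| * |t₀ * q.eval t₀|) ≤ c * (t₀ * q.eval t₀) := by
        rw [← abs_mul]; exact neg_abs_le _
      have h4 : c * (t₀ * q.eval t₀ + c) = c * (t₀ * q.eval t₀) + c ^ 2 := by ring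
      rw [h4]
      have h5 : 0 < |c| := abs_pos.mpr hcne
      nlinarith [sq_abs c]
    have h6 : c * (t₀ ^ e * (t₀ * q.eval t₀ + c)) = t₀ ^ e * (c * (t₀ * q.eval t₀ + c)) := by ring
    rw [h6]; exact mul_pos h1 h2
  -- (3) assemble the new chain
  refine ⟨Fin.cons t₀ a, by simpa using ht₀lt, fun i => by simp, ?_, by simpa using ht₀pos, ?_, ?_⟩
  · rw [Fin.strictMono_iff_lt_succ]
    intro i
    refine Fin.cases ?_ (fun j => ?_) i
    · simpa using ht₀lt
    · rw [← Fin.succ_castSucc]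
      simp only [Fin.cons_succ]
      exact hmono (by exact Fin.castSucc_lt_succ)
  · intro i
    refine Fin.cases ?_ (fun j => ?_) i
    · -- new point against `a 0`
      simp only [Fin.cons_zero, Fin.castSucc_zero, Fin.succ_zero_eq_one]
      have h0 : (Fin.cons t₀ a : Fin (N + 2) → ℝ) 1 = a 0 := by
        rw [← Fin.succ_zero_eq_one]; exact Fin.cons_succ _ _ _
      rw [h0]
      -- signs: c·f(t₀) > 0, s·g(a0) > 0, f(a0)·g(a0) > 0, c·s < 0
      have hcs : c * s < 0 := by rw [hc]; exact hsign
      have h1 : 0 < s * f.eval (a 0) := by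
        -- s g > 0 and f g > 0 ⇒ s f > 0
        have := hkeep 0
        by_contra hcon
        push Not at hcon
        nlinarith [mul_pos hanc this, sq_nonneg (g.eval (a 0))]
      exact mul_neg_of_sign_transfer hnew h1 hcs
    · rw [← Fin.succ_castSucc]
      simp only [Fin.cons_succ]
      exact mul_neg_of_sign_transfer (hkeep j.castSucc) (hkeep j.succ) (halt j)
  · simpa using hnew

/-- Choosing the perturbation: given the bound `η₀ > 0`, the sign target `s ≠ 0` and `ρ = r_e ≠ 0`, the number
`η := -(s * ρ) * (η₀ / (2 * ((s * ρ) ^ 2 + 1)))`… we only need EXISTENCE of a non-zero `η` with `|η| < η₀` and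
`η * ρ * s < 0`. [folklore] -/
theorem exists_small_of_sign (η₀ s ρ : ℝ) (hη₀ : 0 < η₀) (hs : s ≠ 0) (hρ : ρ ≠ 0) :
    ∃ η : ℝ, η ≠ 0 ∧ |η| < η₀ ∧ η * ρ * s < 0 := by
  have hsρ : 0 < (s * ρ) ^ 2 := by positivity
  set τ : ℝ := η₀ / (2 * (|s * ρ| + 1)) with hτ
  have hτpos : 0 < τ := by rw [hτ]; positivity
  refine ⟨-(s * ρ) * τ, ?_, ?_, ?_⟩
  · exact mul_ne_zero (neg_ne_zero.mpr (mul_ne_zero hs hρ)) hτpos.ne'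
  · rw [abs_mul, abs_neg, abs_of_pos hτpos, hτ]
    have h1 : 0 < |s * ρ| + 1 := by positivity
    rw [mul_div_assoc', div_lt_iff₀ (by positivity)]
    nlinarith [abs_nonneg (s * ρ)]
  · have : -(s * ρ) * τ * ρ * s = -(τ * (s * ρ) ^ 2) := by ring
    rw [this]; exact neg_neg_of_pos (mul_pos hτpos hsρ)

/-- **THREE LIFTING STEPS** (the use made of `altChain_lift_step` in RESIDUE-READING §2(g)): switching on three lower-order
terms of orders `e₂ > e₁ > e₀` below a polynomial `g` of order `> e₂`, with hierarchically small coefficients of suitable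
signs, turns an alternation chain of length `N + 1` into one of length `N + 4` — hence at least `N + 3` distinct positive
roots. [folklore] -/
theorem altChain_lift_three (g r₂ r₁ r₀ : ℝ[X]) (e₀ e₁ e₂ : ℕ) (h01 : e₀ < e₁) (h12 : e₁ < e₂)
    (hg : ∀ k ≤ e₂, g.coeff k = 0)
    (hr₂ : ∀ k < e₂, r₂.coeff k = 0) (hr₂e : r₂.coeff e₂ ≠ 0)
    (hr₁ : ∀ k < e₁, r₁.coeff k = 0) (hr₁e : r₁.coeff e₁ ≠ 0)
    (hr₀ : ∀ k < e₀, r₀.coeff k = 0) (hr₀e : r₀.coeff e₀ ≠ 0)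
    (N : ℕ) (s : ℝ) (a : Fin (N + 1) → ℝ) (hchain : AltChain g N s a) :
    ∃ η₂ η₁ η₀ : ℝ, ∃ s' : ℝ, ∃ a' : Fin (N + 4) → ℝ,
      AltChain (g + C η₂ * r₂ + C η₁ * r₁ + C η₀ * r₀) (N + 3) s' a' := by
  have hs : s ≠ 0 := by
    intro h; have := hchain.2.2.2; rw [h, zero_mul] at this; exact lt_irrefl _ this
  -- step 1 (order e₂)
  obtain ⟨b₂, hb₂, H₂⟩ := altChain_lift_step g r₂ e₂ hg hr₂ hr₂e N s a hchain
  obtain ⟨η₂, hη₂, hη₂b, hη₂s⟩ := exists_small_of_sign b₂ s (r₂.coeff e₂) hb₂ hs hr₂e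
  obtain ⟨a₂, -, -, hchain₂⟩ := H₂ η₂ hη₂ hη₂b hη₂s
  set g₂ := g + C η₂ * r₂ with hg₂
  have hg₂c : ∀ k ≤ e₁, g₂.coeff k = 0 := by
    intro k hk
    rw [hg₂, coeff_add, coeff_C_mul, hg k (by omega), hr₂ k (by omega), mul_zero, add_zero]
  have hs₂ : η₂ * r₂.coeff e₂ ≠ 0 := mul_ne_zero hη₂ hr₂e
  -- step 2 (order e₁)
  obtain ⟨b₁, hb₁, H₁⟩ := altChain_lift_step g₂ r₁ e₁ hg₂c hr₁ hr₁e (N + 1) _ a₂ hchain₂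
  obtain ⟨η₁, hη₁, hη₁b, hη₁s⟩ := exists_small_of_sign b₁ _ (r₁.coeff e₁) hb₁ hs₂ hr₁e
  obtain ⟨a₁, -, -, hchain₁⟩ := H₁ η₁ hη₁ hη₁b hη₁s
  set g₁ := g₂ + C η₁ * r₁ with hg₁
  have hg₁c : ∀ k ≤ e₀, g₁.coeff k = 0 := by
    intro k hk
    rw [hg₁, coeff_add, coeff_C_mul, hg₂c k (by omega), hr₁ k (by omega), mul_zero, add_zero]
  have hs₁ : η₁ * r₁.coeff e₁ ≠ 0 := mul_ne_zero hη₁ hr₁e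
  -- step 3 (order e₀)
  obtain ⟨b₀, hb₀, H₀⟩ := altChain_lift_step g₁ r₀ e₀ hg₁c hr₀ hr₀e (N + 2) _ a₁ hchain₁
  obtain ⟨η₀, hη₀, hη₀b, hη₀s⟩ := exists_small_of_sign b₀ _ (r₀.coeff e₀) hb₀ hs₁ hr₀e
  obtain ⟨a₀, -, -, hchain₀⟩ := H₀ η₀ hη₀ hη₀b hη₀s
  exact ⟨η₂, η₁, η₀, _, a₀, hchain₀⟩

end Summit.ValiantsHypothesis.ValiantsHypothesis.Theorems.LacunarySymmetroidMatrixDescartes.Census
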